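import Summits.ValiantsHypothesis.ValiantsHypothesis.Theorems.GrenetZeonDualUnipotentThreeHalvesLongMassTriangularTwo

/-!
# `GrenetZeon.DualUnipotentThreeHalves` (stmt-ValiantsHypothesis-24318), line `slow_core`, stub (c) `SlowCore.LongMassSlowLawInv`:
# JACOBSON'S THEOREM on weakly closed nil spaces — PART 1 (PUSH and CORE)

Jacobson's theorem on weakly closed nil sets (N. Jacobson, *Lie Algebras* (1962), Ch. II §2, Theorem 1: a set `W` of nilpotent linear
transformations of a finite-dimensional space such that every pair `A, B ∈ W` has a scalar `γ(A,B)` with `AB + γ(A,B)·BA ∈ W` generates a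
nilpotent associative algebra) is the common generalisation of Engel's theorem (`γ = −1`, ✓ `NilSpaceEngel`), of nil algebras (`γ = 0`)
and of the JORDAN case (`γ = +1`).  This file holds the two elementary engines of a Lie-theory-free proof for subspaces `V ≤ M_b(ℂ)`;
the theorem itself and the (c)-row it feeds are in the companion file `…LongMassNilSpaceJacobson`.

* §1 coordinate calculus of the LOWEST DIAGONAL («`X i j = 0` whenever `j + (b−1) < t + i`», order `t = 0` vacuous, order `t = b` = strictly
  upper): multiplying by a strictly upper matrix on either side raises the order by one.
* §2 ★ `exists_push` — PUSH: `V` weakly closed, `V₀ ≤ V` strictly upper and containing every strictly upper member of `V`, `V ⊄ 𝔫` ⇒ some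
  `Y ∈ V ∖ 𝔫` has `aY + γ·Ya ∈ V₀` for every `a ∈ V₀` (take `Y` of maximal lowest-diagonal order among `V ∖ 𝔫`: `aY + γ·Ya ∈ V` has larger order,
  so it is strictly upper).
* §3 ★ `exists_step`, `exists_chain`, ★★ `exists_unit_conj_strictUpper_sup_span` — CORE: `V₀` strictly upper, `Y` nilpotent, `aY + γ·Ya ∈ V₀` for
  all `a ∈ V₀` ⇒ `V₀ + ℂY` is simultaneously STRICTLY upper triangularisable.  A complete chain lowered by `V₀` and `Y` is built one vector at
  a time: for a `Y`-stable `G ≠ ⊤` the set `U = {m : V₀·m ⊆ G}` is `Y`-stable (`a(Ym) = (aY + γYa)m − γ·Y(am)`) and contains the first standard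
  basis vector `e_j ∉ G`, so the last iterate `Y^k e_j ∉ G` extends the chain; the matrices lowering the final chain form a product-closed nil
  space, triangularised by ✓ `NilSpaceEngel.exists_unit_conj_strictUpper_of_mulClosed`.

HONEST FRAMING.  Support lemmas (`--supports stmt-ValiantsHypothesis-24318`) for a classical structural law; NOT progress on the research stub (c)
`SlowCore.LongMassSlowLawInv`; closes no stub; S3, 24318, 8062 and `VP ≠ VNP` are NOT proved.  Def-free, no named-fact hypotheses, no sorry.
[cite: Jacobson1962LieAlgebras, Ch. II §2 Thm. 1]
-/

set_option linter.dupNamespace false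
set_option autoImplicit false

noncomputable section

namespace Summit.ValiantsHypothesis.ValiantsHypothesis.Theorems.GrenetZeon.NilSpaceJacobson

open Matrix
open scoped BigOperators
open Summit.ValiantsHypothesis.ValiantsHypothesis.Cruxes.TwoDimCoefficients.DimTwoCases (AffMat IsAffine)
open Summit.ValiantsHypothesis.ValiantsHypothesis.Theorems.GrenetZeon.SlowCore (RelCert)
open Summit.ValiantsHypothesis.ValiantsHypothesis.Theorems.GrenetZeon.TriangularRow (relCert_of_valueSpace_triangularisable_two)
open Summit.ValiantsHypothesis.ValiantsHypothesis.Theorems.GrenetZeon.NilSpaceEngel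

variable {b : ℕ}

/-! ## §1 The lowest diagonal -/

/-- Every matrix vanishes «below diagonal `−(b−1)`» (order `0` of the lowest-diagonal filtration). -/
theorem lowZero_zero (X : Matrix (Fin b) (Fin b) ℂ) : ∀ i j : Fin b, j.val + (b - 1) < 0 + i.val → X i j = 0 := by
  intro i j h
  have hi := i.isLt
  omega

/-- Order `b` of the filtration is «strictly upper triangular». -/
theorem strictUpper_of_lowZero (X : Matrix (Fin b) (Fin b) ℂ) (h : ∀ i j : Fin b, j.val + (b - 1) < b + i.val → X i j = 0) :
    ∀ i j : Fin b, j ≤ i → X i j = 0 := by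
  intro i j hji
  have hi := i.isLt
  exact h i j (by rw [Fin.le_def] at hji; omega)

/-- The filtration is decreasing in the order. -/
theorem lowZero_mono (X : Matrix (Fin b) (Fin b) ℂ) {s t : ℕ} (hst : s ≤ t)
    (h : ∀ i j : Fin b, j.val + (b - 1) < t + i.val → X i j = 0) :
    ∀ i j : Fin b, j.val + (b - 1) < s + i.val → X i j = 0 :=
  fun i j hij => h i j (by omega)

/-- Left multiplication by a strictly upper matrix raises the lowest diagonal. -/
theorem lowZero_strictUpper_mul (a X : Matrix (Fin b) (Fin b) ℂ) (ha : ∀ i j : Fin b, j ≤ i → a i j = 0) {t : ℕ}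
    (hX : ∀ i j : Fin b, j.val + (b - 1) < t + i.val → X i j = 0) :
    ∀ i j : Fin b, j.val + (b - 1) < (t + 1) + i.val → (a * X) i j = 0 := by
  intro i j hij
  rw [Matrix.mul_apply]
  refine Finset.sum_eq_zero fun l _ => ?_
  by_cases hli : l ≤ i
  · rw [ha i l hli, zero_mul]
  · rw [hX l j (by rw [Fin.le_def] at hli; omega), mul_zero]

/-- Right multiplication by a strictly upper matrix raises the lowest diagonal. -/
theorem lowZero_mul_strictUpper (a X : Matrix (Fin b) (Fin b) ℂ) (ha : ∀ i j : Fin b, j ≤ i → a i j = 0) {t : ℕ}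
    (hX : ∀ i j : Fin b, j.val + (b - 1) < t + i.val → X i j = 0) :
    ∀ i j : Fin b, j.val + (b - 1) < (t + 1) + i.val → (X * a) i j = 0 := by
  intro i j hij
  rw [Matrix.mul_apply]
  refine Finset.sum_eq_zero fun l _ => ?_
  by_cases hjl : j ≤ l
  · rw [ha l j hjl, mul_zero]
  · rw [hX i l (by rw [Fin.le_def] at hjl; omega), zero_mul]

/-- The filtration is linear: sums. -/
theorem lowZero_add (X Y : Matrix (Fin b) (Fin b) ℂ) {t : ℕ}
    (hX : ∀ i j : Fin b, j.val + (b - 1) < t + i.val → X i j = 0)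
    (hY : ∀ i j : Fin b, j.val + (b - 1) < t + i.val → Y i j = 0) :
    ∀ i j : Fin b, j.val + (b - 1) < t + i.val → (X + Y) i j = 0 := fun i j hij => by
  rw [Matrix.add_apply, hX i j hij, hY i j hij, add_zero]

/-- The filtration is linear: scalar multiples. -/
theorem lowZero_smul (X : Matrix (Fin b) (Fin b) ℂ) (c : ℂ) {t : ℕ}
    (hX : ∀ i j : Fin b, j.val + (b - 1) < t + i.val → X i j = 0) :
    ∀ i j : Fin b, j.val + (b - 1) < t + i.val → (c • X) i j = 0 := fun i j hij => by
  rw [Matrix.smul_apply, hX i j hij, smul_zero]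

/-! ## §2 PUSH -/

/-- ★ **PUSH.**  Let `V` be weakly closed (`∀ A B ∈ V, ∃ γ, AB + γ·BA ∈ V`), `V₀ ≤ V` a subspace of strictly upper matrices containing every
strictly upper member of `V`, and suppose `V` has a member that is not strictly upper.  Then some `Y ∈ V`, not strictly upper, satisfies
`aY + γ·Ya ∈ V₀` (for some `γ`) for every `a ∈ V₀`.  (Choose `Y` with the highest lowest diagonal among the non-strictly-upper members.)
[cite: Jacobson1962LieAlgebras, Ch. II §2 Thm. 1] -/
theorem exists_push (V V₀ : Submodule ℂ (Matrix (Fin b) (Fin b) ℂ))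
    (hwc : ∀ A ∈ V, ∀ B ∈ V, ∃ γ : ℂ, A * B + γ • (B * A) ∈ V)
    (hV₀V : V₀ ≤ V) (hV₀ : ∀ A ∈ V₀, ∀ i j : Fin b, j ≤ i → A i j = 0)
    (hmax : ∀ A ∈ V, (∀ i j : Fin b, j ≤ i → A i j = 0) → A ∈ V₀)
    (hex : ∃ A ∈ V, ¬ ∀ i j : Fin b, j ≤ i → A i j = 0) :
    ∃ Y ∈ V, (¬ ∀ i j : Fin b, j ≤ i → Y i j = 0) ∧ ∀ a ∈ V₀, ∃ γ : ℂ, a * Y + γ • (Y * a) ∈ V₀ := by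
  classical
  -- `P t`: some non-strictly-upper member of `V` vanishes below diagonal `t − (b − 1)`
  let P : ℕ → Prop := fun t => ∃ A ∈ V, (¬ ∀ i j : Fin b, j ≤ i → A i j = 0) ∧ ∀ i j : Fin b, j.val + (b - 1) < t + i.val → A i j = 0
  have hP0 : P 0 := by
    obtain ⟨A, hA, hnA⟩ := hex
    exact ⟨A, hA, hnA, lowZero_zero A⟩
  set t₀ := Nat.findGreatest P b with ht₀
  have hPt₀ : P t₀ := Nat.findGreatest_spec (P := P) (Nat.zero_le b) hP0
  obtain ⟨Y, hYV, hYn, hYt⟩ := hPt₀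
  -- `t₀ < b`: at order `b` the member would be strictly upper
  have ht₀b : t₀ < b := by
    by_contra hge
    push Not at hge
    exact hYn (strictUpper_of_lowZero Y (lowZero_mono Y hge hYt))
  refine ⟨Y, hYV, hYn, fun a ha => ?_⟩
  obtain ⟨γ, hγ⟩ := hwc a (hV₀V ha) Y hYV
  refine ⟨γ, ?_⟩
  -- the combination has a strictly higher lowest diagonal, hence is strictly upper by maximality of `t₀`
  have hc : ∀ i j : Fin b, j.val + (b - 1) < (t₀ + 1) + i.val → (a * Y + γ • (Y * a)) i j = 0 :=
    lowZero_add _ _ (lowZero_strictUpper_mul a Y (hV₀ a ha) hYt) (lowZero_smul _ γ (lowZero_mul_strictUpper a Y (hV₀ a ha) hYt))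
  by_cases hsu : ∀ i j : Fin b, j ≤ i → (a * Y + γ • (Y * a)) i j = 0
  · exact hmax _ hγ hsu
  · exfalso
    have hP1 : P (t₀ + 1) := ⟨_, hγ, hsu, hc⟩
    have := Nat.le_findGreatest (P := P) (Nat.succ_le_of_lt ht₀b) hP1
    rw [← ht₀] at this
    omega

/-! ## §3 CORE: extending a strictly upper space by one normalising nilpotent matrix -/

/-- A vector is the combination of the standard basis vectors with its own coordinates. -/
theorem eq_sum_smul_single (x : Fin b → ℂ) : x = ∑ i, x i • (Pi.single i (1 : ℂ) : Fin b → ℂ) := by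
  classical
  exact pi_eq_sum_univ' x

/-- Entries of `a *ᵥ e_j`: the `j`-th column. -/
theorem mulVec_single_one_apply (a : Matrix (Fin b) (Fin b) ℂ) (i j : Fin b) :
    (a *ᵥ (Pi.single j (1 : ℂ) : Fin b → ℂ)) i = a i j := by
  classical
  rw [Matrix.mulVec_single_one]
  rfl

/-- A proper submodule misses some standard basis vector. -/
theorem exists_single_not_mem (G : Submodule ℂ (Fin b → ℂ)) (hG : G ≠ ⊤) :
    ∃ j : Fin b, (Pi.single j (1 : ℂ) : Fin b → ℂ) ∉ G := by
  classical
  by_contra h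
  push Not at h
  apply hG
  rw [eq_top_iff]
  intro x _
  rw [eq_sum_smul_single x]
  exact G.sum_mem fun i _ => G.smul_mem _ (h i)

/-- **One step.**  `V₀` strictly upper, `Y` nilpotent with `aY + γ·Ya ∈ V₀` for all `a ∈ V₀`; `G ≠ ⊤` a subspace stable under `Y`.
Then some `m ∉ G` has `V₀ m ⊆ G` and `Y m ∈ G` (the last iterate `Y^k e_j ∉ G` of the first standard basis vector outside `G`). -/
theorem exists_step (V₀ : Submodule ℂ (Matrix (Fin b) (Fin b) ℂ)) (hV₀ : ∀ A ∈ V₀, ∀ i j : Fin b, j ≤ i → A i j = 0)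
    (Y : Matrix (Fin b) (Fin b) ℂ) (hY : IsNilpotent Y) (hrel : ∀ a ∈ V₀, ∃ γ : ℂ, a * Y + γ • (Y * a) ∈ V₀)
    (G : Submodule ℂ (Fin b → ℂ)) (hG : G ≠ ⊤) (hYG : ∀ v ∈ G, Y *ᵥ v ∈ G) :
    ∃ m : Fin b → ℂ, m ∉ G ∧ (∀ a ∈ V₀, a *ᵥ m ∈ G) ∧ Y *ᵥ m ∈ G := by
  classical
  -- (i) a vector outside `G` sent into `G` by `V₀`: the first standard basis vector outside `G`
  obtain ⟨j₀, hj₀⟩ := exists_single_not_mem G hG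
  let s : Finset (Fin b) := Finset.univ.filter fun j => (Pi.single j (1 : ℂ) : Fin b → ℂ) ∉ G
  have hs : s.Nonempty := ⟨j₀, by simp [s, hj₀]⟩
  set j := s.min' hs with hj
  have hjs : j ∈ s := Finset.min'_mem s hs
  have hjG : (Pi.single j (1 : ℂ) : Fin b → ℂ) ∉ G := by simpa [s] using hjs
  have hlt : ∀ i : Fin b, i < j → (Pi.single i (1 : ℂ) : Fin b → ℂ) ∈ G := by
    intro i hij
    by_contra hi
    have his : i ∈ s := by simp [s, hi]
    exact absurd (Finset.min'_le s i his) (by rw [← hj]; exact not_le.mpr hij)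
  set m₁ : Fin b → ℂ := Pi.single j (1 : ℂ) with hm₁
  have hm₁U : ∀ a ∈ V₀, a *ᵥ m₁ ∈ G := by
    intro a ha
    rw [eq_sum_smul_single (a *ᵥ m₁)]
    refine G.sum_mem fun i _ => ?_
    rw [mulVec_single_one_apply]
    by_cases hij : i < j
    · exact G.smul_mem _ (hlt i hij)
    · rw [hV₀ a ha i j (not_lt.mp hij), zero_smul]
      exact G.zero_mem
  -- (ii) the set `U = {m : V₀ m ⊆ G}` is `Y`-stable
  have hU : ∀ m : Fin b → ℂ, (∀ a ∈ V₀, a *ᵥ m ∈ G) → ∀ a ∈ V₀, a *ᵥ (Y *ᵥ m) ∈ G := by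
    intro m hm a ha
    obtain ⟨γ, hγ⟩ := hrel a ha
    have e : a *ᵥ (Y *ᵥ m) = (a * Y + γ • (Y * a)) *ᵥ m - γ • (Y *ᵥ (a *ᵥ m)) := by
      rw [Matrix.add_mulVec, Matrix.smul_mulVec, ← Matrix.mulVec_mulVec, ← Matrix.mulVec_mulVec]
      abel
    rw [e]
    exact G.sub_mem (hm _ hγ) (G.smul_mem _ (hYG _ (hm a ha)))
  -- iterates of `Y` on `m₁` stay in `U`; the last one outside `G` is the wanted vector
  have hiter : ∀ k : ℕ, ∀ a ∈ V₀, a *ᵥ (Y ^ k *ᵥ m₁) ∈ G := by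
    intro k
    induction k with
    | zero => intro a ha; rw [pow_zero, Matrix.one_mulVec]; exact hm₁U a ha
    | succ k ih => intro a ha; rw [pow_succ', ← Matrix.mulVec_mulVec]; exact hU _ ih a ha
  obtain ⟨r, hr⟩ := hY
  have hex : ∃ k : ℕ, Y ^ k *ᵥ m₁ ∈ G := ⟨r, by rw [hr, Matrix.zero_mulVec]; exact G.zero_mem⟩
  set k₀ := Nat.find hex with hk₀
  have hk₀spec : Y ^ k₀ *ᵥ m₁ ∈ G := Nat.find_spec hex
  have hk₀pos : k₀ ≠ 0 := by
    intro h0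
    rw [h0, pow_zero, Matrix.one_mulVec] at hk₀spec
    exact hjG hk₀spec
  obtain ⟨k, hk⟩ : ∃ k, k₀ = k + 1 := Nat.exists_eq_succ_of_ne_zero hk₀pos
  refine ⟨Y ^ k *ᵥ m₁, ?_, hiter k, ?_⟩
  · have := Nat.find_min hex (show k < k₀ by omega)
    exact this
  · rw [Matrix.mulVec_mulVec, ← pow_succ', ← hk]
    exact hk₀spec

/-- **The chain.**  Under the hypotheses of `exists_step`, there is a descending chain `ℂ^b = F₀ ⊇ F₁ ⊇ ⋯ ⊇ F_b = 0` lowered by every `a ∈ V₀` and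
by `Y`. -/
theorem exists_chain (V₀ : Submodule ℂ (Matrix (Fin b) (Fin b) ℂ)) (hV₀ : ∀ A ∈ V₀, ∀ i j : Fin b, j ≤ i → A i j = 0)
    (Y : Matrix (Fin b) (Fin b) ℂ) (hY : IsNilpotent Y) (hrel : ∀ a ∈ V₀, ∃ γ : ℂ, a * Y + γ • (Y * a) ∈ V₀) :
    ∃ F : ℕ → Submodule ℂ (Fin b → ℂ), F 0 = ⊤ ∧ F b = ⊥ ∧ (∀ i, F (i + 1) ≤ F i) ∧
      (∀ a ∈ V₀, ∀ i, ∀ v ∈ F i, a *ᵥ v ∈ F (i + 1)) ∧ (∀ i, ∀ v ∈ F i, Y *ᵥ v ∈ F (i + 1)) := by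
  classical
  -- ascending chain by iteration of the step
  let good : Submodule ℂ (Fin b → ℂ) → Prop := fun G =>
    G ≠ ⊤ ∧ (∀ a ∈ V₀, ∀ v ∈ G, a *ᵥ v ∈ G) ∧ (∀ v ∈ G, Y *ᵥ v ∈ G)
  have hstep : ∀ G, good G → ∃ m : Fin b → ℂ, m ∉ G ∧ (∀ a ∈ V₀, a *ᵥ m ∈ G) ∧ Y *ᵥ m ∈ G :=
    fun G hG => exists_step V₀ hV₀ Y hY hrel G hG.1 hG.2.2
  let next : Submodule ℂ (Fin b → ℂ) → Submodule ℂ (Fin b → ℂ) := fun G =>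
    if hG : good G then G ⊔ (ℂ ∙ Classical.choose (hstep G hG)) else ⊤
  let G : ℕ → Submodule ℂ (Fin b → ℂ) := fun t => next^[t] ⊥
  have hG0 : G 0 = ⊥ := rfl
  have hGsucc : ∀ t, G (t + 1) = next (G t) := fun t => Function.iterate_succ_apply' next t ⊥
  -- invariants: lowering from `G (t+1)` into `G t` (which also gives stability and monotonicity)
  have hinv : ∀ t, (∀ a ∈ V₀, ∀ v ∈ G (t + 1), a *ᵥ v ∈ G t) ∧ (∀ v ∈ G (t + 1), Y *ᵥ v ∈ G t) ∧ G t ≤ G (t + 1) ∧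
      (G (t + 1) = ⊤ ∨ t + 1 ≤ Module.finrank ℂ (G (t + 1))) := by
    intro t
    induction t with
    | zero =>
      rw [hGsucc, hG0]
      by_cases hg : good (⊥ : Submodule ℂ (Fin b → ℂ))
      · have hn : next ⊥ = ⊥ ⊔ (ℂ ∙ Classical.choose (hstep ⊥ hg)) := dif_pos hg
        obtain ⟨hm, hVm, hYm⟩ := Classical.choose_spec (hstep ⊥ hg)
        set m := Classical.choose (hstep ⊥ hg)
        rw [hn, bot_sup_eq]
        refine ⟨fun a ha v hv => ?_, fun v hv => ?_, bot_le, Or.inr ?_⟩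
        · obtain ⟨c, rfl⟩ := Submodule.mem_span_singleton.mp hv
          rw [Matrix.mulVec_smul]; exact (⊥ : Submodule ℂ (Fin b → ℂ)).smul_mem c (hVm a ha)
        · obtain ⟨c, rfl⟩ := Submodule.mem_span_singleton.mp hv
          rw [Matrix.mulVec_smul]; exact (⊥ : Submodule ℂ (Fin b → ℂ)).smul_mem c hYm
        · have hm0 : m ≠ 0 := fun h => hm (by rw [h]; exact Submodule.zero_mem _)
          rw [finrank_span_singleton hm0]
      · have hn : next ⊥ = ⊤ := dif_neg hg
        rw [hn]
        -- `⊥` not good means `⊥ = ⊤` (the stabilities are trivial)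
        have hbt : (⊥ : Submodule ℂ (Fin b → ℂ)) = ⊤ := by
          by_contra hne
          exact hg ⟨hne, fun a _ v hv => by rw [(Submodule.mem_bot ℂ).mp hv, Matrix.mulVec_zero]; exact Submodule.zero_mem _,
            fun v hv => by rw [(Submodule.mem_bot ℂ).mp hv, Matrix.mulVec_zero]; exact Submodule.zero_mem _⟩
        refine ⟨fun a _ v _ => ?_, fun v _ => ?_, bot_le, Or.inl rfl⟩
        · rw [hbt]; exact Submodule.mem_top
        · rw [hbt]; exact Submodule.mem_top
    | succ t ih =>
      obtain ⟨ihV, ihY, ihle, ihrk⟩ := ih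
      rw [hGsucc (t + 1)]
      by_cases hg : good (G (t + 1))
      · have hn : next (G (t + 1)) = G (t + 1) ⊔ (ℂ ∙ Classical.choose (hstep _ hg)) := dif_pos hg
        obtain ⟨hm, hVm, hYm⟩ := Classical.choose_spec (hstep _ hg)
        set m := Classical.choose (hstep _ hg)
        rw [hn]
        refine ⟨fun a ha v hv => ?_, fun v hv => ?_, le_sup_left, ?_⟩
        · obtain ⟨u, hu, w, hw, rfl⟩ := Submodule.mem_sup.mp hv
          obtain ⟨c, rfl⟩ := Submodule.mem_span_singleton.mp hw
          rw [Matrix.mulVec_add, Matrix.mulVec_smul]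
          exact (G (t + 1)).add_mem (hg.2.1 a ha u hu) ((G (t + 1)).smul_mem c (hVm a ha))
        · obtain ⟨u, hu, w, hw, rfl⟩ := Submodule.mem_sup.mp hv
          obtain ⟨c, rfl⟩ := Submodule.mem_span_singleton.mp hw
          rw [Matrix.mulVec_add, Matrix.mulVec_smul]
          exact (G (t + 1)).add_mem (hg.2.2 u hu) ((G (t + 1)).smul_mem c hYm)
        · rcases ihrk with htop | hrk
          · exact absurd htop hg.1
          · right
            have hlt : G (t + 1) < G (t + 1) ⊔ (ℂ ∙ m) := by
              refine lt_of_le_of_ne le_sup_left fun heq => hm ?_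
              rw [heq]; exact Submodule.mem_sup_right (Submodule.mem_span_singleton_self m)
            have := Submodule.finrank_lt_finrank_of_lt hlt
            omega
      · have hn : next (G (t + 1)) = ⊤ := dif_neg hg
        rw [hn]
        have htop : G (t + 1) = ⊤ := by
          by_contra hne
          exact hg ⟨hne, fun a ha v hv => ihle (ihV a ha v hv), fun v hv => ihle (ihY v hv)⟩
        refine ⟨fun a _ v _ => ?_, fun v _ => ?_, le_top, Or.inl rfl⟩
        · rw [htop]; exact Submodule.mem_top
        · rw [htop]; exact Submodule.mem_top
  -- the chain reaches `⊤` at time `b`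
  have hGb : G b = ⊤ := by
    rcases Nat.eq_zero_or_pos b with hb | hb
    · subst hb
      rw [hG0]
      exact Submodule.eq_top_of_finrank_eq (by simp [Module.finrank_fintype_fun_eq_card])
    · obtain ⟨t, rfl⟩ : ∃ t, b = t + 1 := ⟨b - 1, by omega⟩
      rcases (hinv t).2.2.2 with h | h
      · exact h
      · apply Submodule.eq_top_of_finrank_eq
        apply le_antisymm (Submodule.finrank_le _)
        rw [Module.finrank_fintype_fun_eq_card, Fintype.card_fin]
        exact h
  -- descending re-indexing
  refine ⟨fun i => G (b - i), ?_, ?_, fun i => ?_, fun a ha i v hv => ?_, fun i v hv => ?_⟩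
  · show G (b - 0) = ⊤
    rw [Nat.sub_zero, hGb]
  · show G (b - b) = ⊥
    rw [Nat.sub_self, hG0]
  · -- antitone
    show G (b - (i + 1)) ≤ G (b - i)
    rcases Nat.lt_or_ge i b with hib | hib
    · have e : b - i = (b - (i + 1)) + 1 := by omega
      rw [e]; exact (hinv _).2.2.1
    · have e1 : b - (i + 1) = 0 := by omega
      have e2 : b - i = 0 := by omega
      rw [e1, e2]
  · change v ∈ G (b - i) at hv
    show a *ᵥ v ∈ G (b - (i + 1))
    rcases Nat.lt_or_ge i b with hib | hib
    · have e : b - i = (b - (i + 1)) + 1 := by omega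
      rw [e] at hv; exact (hinv _).1 a ha v hv
    · have e2 : b - i = 0 := by omega
      rw [e2, hG0, Submodule.mem_bot] at hv
      rw [hv, Matrix.mulVec_zero]; exact Submodule.zero_mem _
  · change v ∈ G (b - i) at hv
    show Y *ᵥ v ∈ G (b - (i + 1))
    rcases Nat.lt_or_ge i b with hib | hib
    · have e : b - i = (b - (i + 1)) + 1 := by omega
      rw [e] at hv; exact (hinv _).2.1 v hv
    · have e2 : b - i = 0 := by omega
      rw [e2, hG0, Submodule.mem_bot] at hv
      rw [hv, Matrix.mulVec_zero]; exact Submodule.zero_mem _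

/-- ★ **CORE.**  `V₀ ≤ M_b(ℂ)` strictly upper, `Y` nilpotent, `aY + γ·Ya ∈ V₀` (some `γ`) for every `a ∈ V₀`: then `V₀ + ℂY` is simultaneously
STRICTLY upper triangularisable by one unit. [cite: Jacobson1962LieAlgebras, Ch. II §2 Thm. 1] -/
theorem exists_unit_conj_strictUpper_sup_span (V₀ : Submodule ℂ (Matrix (Fin b) (Fin b) ℂ))
    (hV₀ : ∀ A ∈ V₀, ∀ i j : Fin b, j ≤ i → A i j = 0)
    (Y : Matrix (Fin b) (Fin b) ℂ) (hY : IsNilpotent Y) (hrel : ∀ a ∈ V₀, ∃ γ : ℂ, a * Y + γ • (Y * a) ∈ V₀) :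
    ∃ P : (Matrix (Fin b) (Fin b) ℂ)ˣ, ∀ A ∈ V₀ ⊔ (ℂ ∙ Y), ∀ i j : Fin b, j ≤ i →
      ((P : Matrix (Fin b) (Fin b) ℂ) * A * (↑P⁻¹ : Matrix (Fin b) (Fin b) ℂ)) i j = 0 := by
  obtain ⟨F, hF0, hFb, hanti, hlowV, hlowY⟩ := exists_chain V₀ hV₀ Y hY hrel
  -- the algebra of all matrices lowering the chain: a product-closed nil space containing `V₀` and `Y`
  let K : Submodule ℂ (Matrix (Fin b) (Fin b) ℂ) :=
    { carrier := {X | ∀ i, ∀ v ∈ F i, X *ᵥ v ∈ F (i + 1)}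
      add_mem' := fun {X X'} hX hX' i v hv => by
        rw [Matrix.add_mulVec]; exact (F (i + 1)).add_mem (hX i v hv) (hX' i v hv)
      zero_mem' := fun i v _ => by rw [Matrix.zero_mulVec]; exact (F (i + 1)).zero_mem
      smul_mem' := fun c X hX i v hv => by
        rw [Matrix.smul_mulVec]; exact (F (i + 1)).smul_mem c (hX i v hv) }
  have hKmem : ∀ X : Matrix (Fin b) (Fin b) ℂ, X ∈ K ↔ ∀ i, ∀ v ∈ F i, X *ᵥ v ∈ F (i + 1) := fun X => Iff.rfl
  have hKnil : ∀ X ∈ K, IsNilpotent X := fun X hX => ⟨b, pow_eq_zero_of_lowers F hF0 hFb X ((hKmem X).mp hX)⟩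
  have hKmul : ∀ X ∈ K, ∀ X' ∈ K, X * X' ∈ K := by
    intro X hX X' hX'
    rw [hKmem] at hX hX' ⊢
    intro i v hv
    rw [← Matrix.mulVec_mulVec]
    exact hanti (i + 1) (hX (i + 1) _ (hX' i v hv))
  obtain ⟨P, hP⟩ := exists_unit_conj_strictUpper_of_mulClosed K hKnil hKmul
  have hle : V₀ ⊔ (ℂ ∙ Y) ≤ K := by
    refine sup_le (fun a ha => (hKmem a).mpr (hlowV a ha)) ?_
    rw [Submodule.span_singleton_le_iff_mem]
    exact (hKmem Y).mpr hlowY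
  exact ⟨P, fun A hA => hP A (hle hA)⟩

end Summit.ValiantsHypothesis.ValiantsHypothesis.Theorems.GrenetZeon.NilSpaceJacobson

end
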